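import Summits.CriticalPhenomena.PercolationContinuityZ3.Theorems.Transplant.SkelFrmFromBParamsFaceFloorsX2SA
import Summits.CriticalPhenomena.PercolationContinuityZ3.Theorems.Transplant.SkelFrmBParamsFaceFloorsX2SA
import Summits.CriticalPhenomena.PercolationContinuityZ3.Theorems.Transplant.SkelFrmFromBParamsFaceFloorsX2WA
import Summits.CriticalPhenomena.PercolationContinuityZ3.Theorems.Transplant.SkelFrmBParamsFaceFloorsX2WA
import Summits.CriticalPhenomena.PercolationContinuityZ3.Theorems.Transplant.SkelFrmFromBParamsFaceFloorsXGenA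
import Summits.CriticalPhenomena.PercolationContinuityZ3.Theorems.Transplant.SkelFrmBParamsFaceFloorsXGenA
import Summits.CriticalPhenomena.PercolationContinuityZ3.Theorems.Transplant.SkelFrmFromBParamsFaceOriginsXLA
import Summits.CriticalPhenomena.PercolationContinuityZ3.Theorems.Transplant.SkelFrmBParamsFaceOriginsXLA
import Summits.CriticalPhenomena.PercolationContinuityZ3.Theorems.Transplant.SkelFrmFromBParamsFaceFloorsL2XA
import Summits.CriticalPhenomena.PercolationContinuityZ3.Theorems.Transplant.SkelFrmBParamsFaceFloorsL2XA
import Summits.CriticalPhenomena.PercolationContinuityZ3.Theorems.Transplant.SkelFrmFromBParamsFaceFloorsFitXA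
import Summits.CriticalPhenomena.PercolationContinuityZ3.Theorems.Transplant.SkelFrmBParamsFaceFloorsFitXA
import Summits.CriticalPhenomena.PercolationContinuityZ3.Theorems.Transplant.SkelFrmFromBParamsFaceFloorsClrXA
import Summits.CriticalPhenomena.PercolationContinuityZ3.Theorems.Transplant.SkelFrmBParamsFaceFloorsClrXA
import Summits.CriticalPhenomena.PercolationContinuityZ3.Theorems.Transplant.SkelFrmFromBParamsFaceFloorsZXA
import Summits.CriticalPhenomena.PercolationContinuityZ3.Theorems.Transplant.SkelFrmBParamsFaceFloorsZXA
import Summits.CriticalPhenomena.PercolationContinuityZ3.Theorems.Transplant.SkelFrmFromBParamsFaceFloorsPiXA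
import Summits.CriticalPhenomena.PercolationContinuityZ3.Theorems.Transplant.SkelFrmBParamsFaceFloorsPiXA
import Summits.CriticalPhenomena.PercolationContinuityZ3.Theorems.Transplant.SkelFrmFromBParamsFaceFloorsTXAR0
import Summits.CriticalPhenomena.PercolationContinuityZ3.Theorems.Transplant.SkelFrmBParamsFaceFloorsTXAR0
import Summits.CriticalPhenomena.PercolationContinuityZ3.Theorems.Transplant.SkelFrmFromBParamsFaceFloorsAXAR0
import Summits.CriticalPhenomena.PercolationContinuityZ3.Theorems.Transplant.SkelFrmBParamsFaceFloorsAXAR0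
import Summits.CriticalPhenomena.PercolationContinuityZ3.Theorems.Transplant.SkelFrmFromBParamsFaceFloorsAXA2R0
import Summits.CriticalPhenomena.PercolationContinuityZ3.Theorems.Transplant.SkelFrmBParamsFaceFloorsAXA2R0
import Summits.CriticalPhenomena.PercolationContinuityZ3.Theorems.Transplant.SkelFrmFromBParamsFaceFloorsTYA
import Summits.CriticalPhenomena.PercolationContinuityZ3.Theorems.Transplant.SkelFrmBParamsFaceFloorsTYA
import Summits.CriticalPhenomena.PercolationContinuityZ3.Theorems.Transplant.SkelFrmFromBParamsFaceFloorsAYA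
import Summits.CriticalPhenomena.PercolationContinuityZ3.Theorems.Transplant.SkelFrmBParamsFaceFloorsAYA
import Summits.CriticalPhenomena.PercolationContinuityZ3.Theorems.Transplant.SkelPhiFaceNumsXP2T
import Summits.CriticalPhenomena.PercolationContinuityZ3.Theorems.Transplant.SkelFrmFromBParamsFaceCountsShiftA
import Summits.CriticalPhenomena.PercolationContinuityZ3.Theorems.Transplant.SkelFrmBParamsFaceCountsShiftA
import Summits.CriticalPhenomena.PercolationContinuityZ3.Theorems.Transplant.SkelFrmFromBChoiceWindow
import Summits.CriticalPhenomena.PercolationContinuityZ3.Theorems.Transplant.SkelFrmBChoiceWindow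
import Summits.CriticalPhenomena.PercolationContinuityZ3.Theorems.Transplant.PlanarSkeletonFrmFromDefs
import Summits.CriticalPhenomena.PercolationContinuityZ3.Theorems.Transplant.PlanarSkeletonFrmDefs
import Summits.CriticalPhenomena.PercolationContinuityZ3.Theorems.Transplant.SkelPhiStepIDataNS
import HarnessLib
import Summits.CriticalPhenomena.PercolationContinuityZ3.Theorems.Transplant.SkelFrmBParamsFaceFloorsX2WB
/-!
# U-WAVE PORT (RULING D-U, lead g21 2026-08-26; WAVE-U-MANIFEST v3.1 row «SkelFrmBParamsFaceFloorsX2WB» ↦ «SkelFrmFromBParamsFaceFloorsX2WB») of the tree module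
# `Transplant/SkelFrmBParamsFaceFloorsX2WB` onto the carrier `PlanarSkeletonFrmFrom` (frames only, cylinders connected from width `ℓ₀` on)

ORIGINAL TITLE: N2 (frames-only node, OPEN) — (F) value layer under (R-44)(c): **THE ONE-SIDED x-FACE ASSEMBLY `KS.floorsX2_XFsW`** (hp-8 g43)

builds on p205010 (kernel theorem, internal audit signed; external expert review pending) — nothing in this file uses p205010; NOTHING is claimed about the
OPEN node U `SamePDropOfSkeletonFrmFrom₁` (nor U_s / the end state).  Lane `prim-bschramm`, seat `prim-bschramm-stmt` gen 26 (port pen, RULING M-11 family P-stmt; tool = p3-g26's port_u.py of record, registry-driven inputs); helper file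
(`--supports stmt-CriticalPhenomena-4575 --as helper`).  PORT RULES r1–r4 of RULING D-U: declaration order and proof texts are those of the original,
byte-identical except (i) the carrier token `PlanarSkeletonFrm ↦ PlanarSkeletonFrmFrom` (binders, `namespace`/`end` lines, qualified names of twinned
declarations), (ii) carrier-FREE declarations of the original (φ-level `Skelφ…` blocks and namespace-only arithmetic residents) are NOT re-declared —
this file imports the original and `export`s the twin-free residents (POLICY T / treatment (m1)); residents whose statement mentions a twinned
constant are copied, (iii) every carrier-binding declaration keeps its explicit binder `(Φ : PlanarSkeletonFrmFrom G)` in its own signature (r2).  Docstrings and citations are the original's.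
-/

noncomputable section

open scoped Classical

namespace Summit.CriticalPhenomena.PercolationContinuityZ3.Theorems.Transplant

namespace PlanarSkeletonFrmFrom

namespace NegB

open Literature.Probability.Percolation Literature.Probability.LatticeModels SimpleGraph KNCells KNLevels
open Literature.Probability.Percolation.KozmaNitzan.Cells (oth sgOf sgOf_sign stepVec_apply_fst)
open SkelConc (Consts)
open Skelφ (shearUnit shearUnit_pos)
open Skelφ.StepI (DataN)
open ChainPlanar (BridgePrm)
open TwoAxis.Para (modulus)
open Neg

namespace KS

set_option maxHeartbeats 4000000 in
/-- **(R-44)(c) ONE-SIDED x-face assembly: `Skelφ.FloorsX2T` at the (ζ′) tuple, bridge case same, tangential sign `σT := 1`, window count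
`N₃ := N3WX … bwX`, window of record `b₀ := BSlot.small3`** — all 27 fields (the T assembly `floorsX2_XFs` with the one-sided counts; extra premise = the
forward-start row `hTw : 3·u₁ ≤ T1X + bwX`, the origin bound being the sharp `|F1cA yL| ≤ 2u₁` of `abs_F1cA_le_of_Λ₁`). [cite: KozmaNitzan2024, §4 Lemma 11–12 (pp. 21–25)] -/
theorem floorsX2_XFsW (κ : Consts) {V : Type} [DecidableEq V] [Countable V] {G : SimpleGraph V} [G.LocallyFinite] (Φ : PlanarSkeletonFrmFrom G) (t : V) (p : unitInterval) (D : Skelφ.StepI.DataNS V) (c : ℕ) (mk : ℕ) (gx : Neg.FSlot) (fx : Neg.FSlot) (P : PCells2T) (hP : P.toPCells2 = fcellsA κ Φ t p D (gT mk gx κ Φ t p D) (fT mk fx κ Φ t p D))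
    (hN : EqNumL κ Φ t p D (gT mk gx κ Φ t p D) (fT mk fx κ Φ t p D))
    (hκ : (hL κ Φ t p D (gT mk gx κ Φ t p D) (fT mk fx κ Φ t p D)).natAbs ≤ 10 * nL κ Φ t p D (gT mk gx κ Φ t p D) (fT mk fx κ Φ t p D))
    (hnA : 2000 * Neg.Kq κ * (KS0.R'0 κ Φ t p D mk + 2) ≤ nL κ Φ t p D (gT mk gx κ Φ t p D) (fT mk fx κ Φ t p D))
    (hℓA : 22000 * Neg.Kq κ * (KS0.R'0 κ Φ t p D mk + 2) ≤ ℓL κ Φ t p D (gT mk gx κ Φ t p D) (fT mk fx κ Φ t p D))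
    (hnA24 : 2400 * Neg.Kq κ * (KS0.R'0 κ Φ t p D mk + 2) ≤ nL κ Φ t p D (gT mk gx κ Φ t p D) (fT mk fx κ Φ t p D))
    (hS : 16 * SF κ Φ t p D c mk ≤ ML κ Φ t p D (gT mk gx κ Φ t p D)) (hR0 : 22000 * (KS0.R'0 κ Φ t p D mk + 2) ≤ ML κ Φ t p D (gT mk gx κ Φ t p D))
    (hu2 : 2 ≤ u₁A κ Φ t p D (gT mk gx κ Φ t p D) (fT mk fx κ Φ t p D))
    (hs0 : 6 * (KS0.R'0 κ Φ t p D mk : ℤ) + 11 ≤ u₀A κ Φ t p D (gT mk gx κ Φ t p D) (fT mk fx κ Φ t p D))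
    (hkF0 : kF₀A κ Φ t p D c mk (gT mk gx κ Φ t p D) (fT mk fx κ Φ t p D) ≤ 8 * u₀A κ Φ t p D (gT mk gx κ Φ t p D) (fT mk fx κ Φ t p D) + 1)
    (hkF1 : kF₁A κ Φ t p D c mk (gT mk gx κ Φ t p D) (fT mk fx κ Φ t p D) ≤ 8 * u₁A κ Φ t p D (gT mk gx κ Φ t p D) (fT mk fx κ Φ t p D) + 1)
    (x : Site 2) (du : MDir) (hd : du.1 = 0) (j : ℕ) (hj : j < P.K) (z : Site 2) {E : ℕ} {kE : ℤ}
    (hlev1 : (P.faceL 0 j : ℤ) - E ≤ P.lev du x z)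
    (hlev2 : P.lev du x z ≤ P.faceL 0 j + E)
    (hz : |z 1 - P.cenS x 1| ≤ kE)
    (hEu : (E : ℤ) ≤ u₀A κ Φ t p D (gT mk gx κ Φ t p D) (fT mk fx κ Φ t p D))
    (hkE : kE ≤ 5 * (P.r 1 : ℤ))
    (hkE2 : 2 * kE + 8 * u₁A κ Φ t p D (gT mk gx κ Φ t p D) (fT mk fx κ Φ t p D) + 8 + 2 * (P.c 0 : ℤ) ≤ 5 * (P.r 1 : ℤ))
    (hE2 : (E : ℤ) ≤ 2 * (KS0.R'0 κ Φ t p D mk : ℤ))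
    -- ONE-SIDED ((R-44)(c)): the forward-start row at this contact (from DESIGN W's window reading + the value row, lane 13:58Z)
    (hTw : 3 * u₁A κ Φ t p D (gT mk gx κ Φ t p D) (fT mk fx κ Φ t p D) ≤ T1X P x du z + (bwX κ Φ t p D (gT mk gx κ Φ t p D) (fT mk fx κ Φ t p D)))
    (r : ℕ) (hr : πBudX κ Φ t p D c mk (gT mk gx κ Φ t p D) (fT mk fx κ Φ t p D) ≤ r) :
    Skelφ.FloorsX2T (prFA κ Φ t p D (gT mk gx κ Φ t p D) (fT mk fx κ Φ t p D)) (nL κ Φ t p D (gT mk gx κ Φ t p D) (fT mk fx κ Φ t p D)) (u₀A κ Φ t p D (gT mk gx κ Φ t p D) (fT mk fx κ Φ t p D)) (u₁A κ Φ t p D (gT mk gx κ Φ t p D) (fT mk fx κ Φ t p D))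
      (modulus (nL κ Φ t p D (gT mk gx κ Φ t p D) (fT mk fx κ Φ t p D)) (hL κ Φ t p D (gT mk gx κ Φ t p D) (fT mk fx κ Φ t p D)) (vL κ Φ t p D (gT mk gx κ Φ t p D) (fT mk fx κ Φ t p D)) (vβL κ Φ t p D (gT mk gx κ Φ t p D) (fT mk fx κ Φ t p D))) (nL κ Φ t p D (gT mk gx κ Φ t p D) (fT mk fx κ Φ t p D) : ℤ) (ℓL κ Φ t p D (gT mk gx κ Φ t p D) (fT mk fx κ Φ t p D))
      P (NegB.BSlot.small3 κ Φ t p D (gT mk gx κ Φ t p D) (fT mk fx κ Φ t p D)) x du j 3 r (Mu D) z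
      (fun i => if i = 0 then kF₀A κ Φ t p D c mk (gT mk gx κ Φ t p D) (fT mk fx κ Φ t p D) else kF₁A κ Φ t p D c mk (gT mk gx κ Φ t p D) (fT mk fx κ Φ t p D))
      (BFs κ Φ t p D c mk (gT mk gx κ Φ t p D) (fT mk fx κ Φ t p D) (sgOf du)) (KS0.R'0 κ Φ t p D mk) (qBXFs κ Φ t p D mk) (KS0.R'0 κ Φ t p D mk) (qB3XA κ Φ t p D (gT mk gx κ Φ t p D) (fT mk fx κ Φ t p D) (KS0.R'0 κ Φ t p D mk))
      (yLXFs κ Φ t p D c mk (gT mk gx κ Φ t p D) (fT mk fx κ Φ t p D) (sgOf du)) (NrX κ Φ t p D (gT mk gx κ Φ t p D) (fT mk fx κ Φ t p D) P (yLXFs κ Φ t p D c mk (gT mk gx κ Φ t p D) (fT mk fx κ Φ t p D) (sgOf du)) 1 x du z) (N3WX κ Φ t p D (gT mk gx κ Φ t p D) (fT mk fx κ Φ t p D) P (yLXFs κ Φ t p D c mk (gT mk gx κ Φ t p D) (fT mk fx κ Φ t p D) (sgOf du)) x du z (bwX κ Φ t p D (gT mk gx κ Φ t p D) (fT mk fx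 κ Φ t p D))) 1 := by
  have hσ : sgOf du = 1 ∨ sgOf du = -1 := sgOf_sign du
  obtain ⟨hΛ₀, hΛ₁⟩ := Λ_yLXFs κ Φ t p D c mk (fT mk fx κ Φ t p D) gx hN hκ hS hR0 hσ
  have hσT : (1 : ℤ) = 1 ∨ (1 : ℤ) = -1 := Or.inl rfl
  have he0 := he0_of_Λ₀ κ Φ t p D (gT mk gx κ Φ t p D) (fT mk fx κ Φ t p D) hN (yLXFs κ Φ t p D c mk (gT mk gx κ Φ t p D) (fT mk fx κ Φ t p D) (sgOf du)) hΛ₀ hσT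
  have he1 := he1_of_Λ₁ κ Φ t p D (gT mk gx κ Φ t p D) (fT mk fx κ Φ t p D) hN (yLXFs κ Φ t p D c mk (gT mk gx κ Φ t p D) (fT mk fx κ Φ t p D) (sgOf du)) hΛ₁
  have hq4 := four_qBXFs_le κ Φ t p D mk gx fx hnA
  have hyL := hyL_XFs κ Φ t p D c mk (gT mk gx κ Φ t p D) (fT mk fx κ Φ t p D) hσ
  have hyl := yLXFs_l1 κ Φ t p D c mk gx fx hσ
  have hu0 : 1 ≤ u₀A κ Φ t p D (gT mk gx κ Φ t p D) (fT mk fx κ Φ t p D) := (units_eqA κ Φ t p D (gT mk gx κ Φ t p D) (fT mk fx κ Φ t p D)).2.2.2.2.1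
  have hu1 : 1 ≤ u₁A κ Φ t p D (gT mk gx κ Φ t p D) (fT mk fx κ Φ t p D) := (units_eqA κ Φ t p D (gT mk gx κ Φ t p D) (fT mk fx κ Φ t p D)).2.2.2.2.2
  have hbw2 : u₁A κ Φ t p D (gT mk gx κ Φ t p D) (fT mk fx κ Φ t p D) ≤ 2 * ((bwX κ Φ t p D (gT mk gx κ Φ t p D) (fT mk fx κ Φ t p D)) : ℤ) := (bwX_eq κ Φ t p D (gT mk gx κ Φ t p D) (fT mk fx κ Φ t p D)).2
  have he1t : |F1cA κ Φ t p D (gT mk gx κ Φ t p D) (fT mk fx κ Φ t p D) (yLXFs κ Φ t p D c mk (gT mk gx κ Φ t p D) (fT mk fx κ Φ t p D) (sgOf du))| ≤ 2 * u₁A κ Φ t p D (gT mk gx κ Φ t p D) (fT mk fx κ Φ t p D) := abs_F1cA_le_of_Λ₁ κ Φ t p D (gT mk gx κ Φ t p D) (fT mk fx κ Φ t p D) hN (yLXFs κ Φ t p D c mk (gT mk gx κ Φ t p D) (fT mk fx κ Φ t p D) (sgOf du)) hΛ₁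
  have hFst : F1cA κ Φ t p D (gT mk gx κ Φ t p D) (fT mk fx κ Φ t p D) (yLXFs κ Φ t p D c mk (gT mk gx κ Φ t p D) (fT mk fx κ Φ t p D) (sgOf du)) + u₁A κ Φ t p D (gT mk gx κ Φ t p D) (fT mk fx κ Φ t p D) ≤ T1X P x du z + (bwX κ Φ t p D (gT mk gx κ Φ t p D) (fT mk fx κ Φ t p D)) := by
    have := (abs_le.1 he1t).2; linarith
  obtain ⟨hrP, hsP, hKP⟩ := cells_of_hP κ Φ t p D (gT mk gx κ Φ t p D) (fT mk fx κ Φ t p D) P hP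
  have hr0 : (P.r 0 : ℤ) = 40 * (Neg.Kq κ : ℤ) * u₀A κ Φ t p D (gT mk gx κ Φ t p D) (fT mk fx κ Φ t p D) := by rw [hrP 0]; exact (units_eqA κ Φ t p D (gT mk gx κ Φ t p D) (fT mk fx κ Φ t p D)).2.2.1
  have hr1 : (P.r 1 : ℤ) = 40 * (Neg.Kq κ : ℤ) * u₁A κ Φ t p D (gT mk gx κ Φ t p D) (fT mk fx κ Φ t p D) := by rw [hrP 1]; exact (units_eqA κ Φ t p D (gT mk gx κ Φ t p D) (fT mk fx κ Φ t p D)).2.2.2.1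
  have es0 : ((P.s 0 : ℕ) : ℤ) = u₀A κ Φ t p D (gT mk gx κ Φ t p D) (fT mk fx κ Φ t p D) := by rw [hsP 0]; rfl
  have hc0 : (0 : ℤ) ≤ P.c 0 := P.c_nonneg 0
  have hq1 : (1 : ℤ) ≤ Neg.Kq κ := by exact_mod_cast Neg.one_le_Kq κ
  have hR0' : (0 : ℤ) ≤ (KS0.R'0 κ Φ t p D mk : ℤ) := by positivity
  have ha0 : 0 ≤ kE := (abs_nonneg _).trans hz
  have hkE8 : kE + 8 * u₁A κ Φ t p D (gT mk gx κ Φ t p D) (fT mk fx κ Φ t p D) + 8 + P.c 0 ≤ 5 * (P.r 1 : ℤ) := by linarith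
  obtain ⟨hX, hNr⟩ := NrX_range κ Φ t p D (gT mk gx κ Φ t p D) (fT mk fx κ Φ t p D) P hP hN x du hd z hj hlev1 hlev2 (yLXFs κ Φ t p D c mk (gT mk gx κ Φ t p D) (fT mk fx κ Φ t p D) (sgOf du)) 1 he0 (by linarith)
  have hN3 := N3WX_range κ Φ t p D (gT mk gx κ Φ t p D) (fT mk fx κ Φ t p D) P hP (yLXFs κ Φ t p D c mk (gT mk gx κ Φ t p D) (fT mk fx κ Φ t p D) (sgOf du)) x du hd z hz hkE he1 (by linarith) hbw2 hFst
  obtain ⟨hLk, hLℓ⟩ := floorsL_conds κ Φ t p D (gT mk gx κ Φ t p D) (fT mk fx κ Φ t p D) mk hN3 hnA hℓA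
  obtain ⟨-, hWlo, hWhi⟩ := N3WX_spec κ Φ t p D (gT mk gx κ Φ t p D) (fT mk fx κ Φ t p D) P (yLXFs κ Φ t p D c mk (gT mk gx κ Φ t p D) (fT mk fx κ Φ t p D) (sgOf du)) x du z hbw2 hFst
  have hsm0 : ((NegB.BSlot.small κ Φ t p D (gT mk gx κ Φ t p D) (fT mk fx κ Φ t p D) 0 : ℕ) : ℤ) ≤ ((NegB.BSlot.small3 κ Φ t p D (gT mk gx κ Φ t p D) (fT mk fx κ Φ t p D) 0 : ℕ) : ℤ) := by
    rw [(NegB.small_eq κ Φ t p D (gT mk gx κ Φ t p D) (fT mk fx κ Φ t p D)).1, (NegB.small3_eq κ Φ t p D (gT mk gx κ Φ t p D) (fT mk fx κ Φ t p D)).1]; push_cast; linarith [Nat.cast_nonneg (α := ℤ) ((fcellsA κ Φ t p D (gT mk gx κ Φ t p D) (fT mk fx κ Φ t p D)).s 0)]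
  have hnm0 : (0 : ℤ) ≤ (nL κ Φ t p D (gT mk gx κ Φ t p D) (fT mk fx κ Φ t p D) : ℤ) * modulus (nL κ Φ t p D (gT mk gx κ Φ t p D) (fT mk fx κ Φ t p D)) (hL κ Φ t p D (gT mk gx κ Φ t p D) (fT mk fx κ Φ t p D)) (vL κ Φ t p D (gT mk gx κ Φ t p D) (fT mk fx κ Φ t p D)) (vβL κ Φ t p D (gT mk gx κ Φ t p D) (fT mk fx κ Φ t p D)) := by
    obtain ⟨hn1, hℓ1⟩ := one_le_of_eqNumL κ Φ t p D (gT mk gx κ Φ t p D) (fT mk fx κ Φ t p D) hN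
    exact mul_nonneg (by positivity) (Skelφ.NegPrm.modulus_vβOf_pos hn1 hℓ1 _ _).le
  have hNr1000 : NrX κ Φ t p D (gT mk gx κ Φ t p D) (fT mk fx κ Φ t p D) P (yLXFs κ Φ t p D c mk (gT mk gx κ Φ t p D) (fT mk fx κ Φ t p D) (sgOf du)) 1 x du z + 1 ≤ 1000 * Neg.Kq κ := by have := Neg.one_le_Kq κ; omega
  have hkN : ∀ k ≤ NrX κ Φ t p D (gT mk gx κ Φ t p D) (fT mk fx κ Φ t p D) P (yLXFs κ Φ t p D c mk (gT mk gx κ Φ t p D) (fT mk fx κ Φ t p D) (sgOf du)) 1 x du z, k + 1 ≤ 1000 * Neg.Kq κ := fun k hk => by omega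
  have hk3 : ∀ k ≤ N3WX κ Φ t p D (gT mk gx κ Φ t p D) (fT mk fx κ Φ t p D) P (yLXFs κ Φ t p D c mk (gT mk gx κ Φ t p D) (fT mk fx κ Φ t p D) (sgOf du)) x du z (bwX κ Φ t p D (gT mk gx κ Φ t p D) (fT mk fx κ Φ t p D)), k + 1 ≤ 240 * Neg.Kq κ + 10 := fun k hk => by omega
  have hk3' : ∀ k ≤ N3WX κ Φ t p D (gT mk gx κ Φ t p D) (fT mk fx κ Φ t p D) P (yLXFs κ Φ t p D c mk (gT mk gx κ Φ t p D) (fT mk fx κ Φ t p D) (sgOf du)) x du z (bwX κ Φ t p D (gT mk gx κ Φ t p D) (fT mk fx κ Φ t p D)), k + 1 ≤ 1000 * Neg.Kq κ := fun k hk => by have := Neg.one_le_Kq κ; omega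
  have hΛ₁3 : |Λ₁of κ Φ t p D (gT mk gx κ Φ t p D) (fT mk fx κ Φ t p D) (yLXFs κ Φ t p D c mk (gT mk gx κ Φ t p D) (fT mk fx κ Φ t p D) (sgOf du))| ≤ 3 * modulus (nL κ Φ t p D (gT mk gx κ Φ t p D) (fT mk fx κ Φ t p D)) (hL κ Φ t p D (gT mk gx κ Φ t p D) (fT mk fx κ Φ t p D)) (vL κ Φ t p D (gT mk gx κ Φ t p D) (fT mk fx κ Φ t p D)) (vβL κ Φ t p D (gT mk gx κ Φ t p D) (fT mk fx κ Φ t p D)) :=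
    hΛ₁.trans (by linarith [abs_nonneg (Λ₁of κ Φ t p D (gT mk gx κ Φ t p D) (fT mk fx κ Φ t p D) (yLXFs κ Φ t p D c mk (gT mk gx κ Φ t p D) (fT mk fx κ Φ t p D) (sgOf du)))])
  -- along: faceL, target, far end
  have hfl : P.faceL 0 j = 5 * (P.r 0 : ℤ) + 10 * u₀A κ Φ t p D (gT mk gx κ Φ t p D) (fT mk fx κ Φ t p D) * ((j : ℤ) + 1) - 1 := by
    show P.toPCells2.faceL 0 j = 5 * (P.toPCells2.r 0 : ℤ) + 10 * u₀A κ Φ t p D (gT mk gx κ Φ t p D) (fT mk fx κ Φ t p D) * ((j : ℤ) + 1) - 1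
    unfold PCells2.faceL
    have es : (P.toPCells2.s 0 : ℤ) = u₀A κ Φ t p D (gT mk gx κ Φ t p D) (fT mk fx κ Φ t p D) := by rw [hsP 0]; rfl
    rw [es]; push_cast; ring
  have hlev : 5 * (P.r 0 : ℤ) + 10 * u₀A κ Φ t p D (gT mk gx κ Φ t p D) (fT mk fx κ Φ t p D) * ((j : ℤ) + 1) - 1 - E ≤ P.lev du x z := by
    rw [← hfl]; exact hlev1
  have hjr : u₀A κ Φ t p D (gT mk gx κ Φ t p D) (fT mk fx κ Φ t p D) * ((j : ℤ) + 1) ≤ (P.r 0 : ℤ) := by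
    have hj' : ((j : ℤ) + 1) ≤ (P.K : ℤ) := by exact_mod_cast hj
    have hrK : (P.r 0 : ℤ) = (P.K : ℤ) * u₀A κ Φ t p D (gT mk gx κ Φ t p D) (fT mk fx κ Φ t p D) := by rw [hrP 0, hKP, PCells2.r_eq]; unfold u₀A; ring
    rw [hrK]; nlinarith
  -- the along rows at the ALIGNED cells (p1's AXAR0/AXA2R0/TXAR0 read `(fcellsA …).r`/`.cen`): transport `r` by `hrP`, the level bound verbatim
  have hlevA : 5 * ((fcellsA κ Φ t p D (gT mk gx κ Φ t p D) (fT mk fx κ Φ t p D)).r 0 : ℤ) + 10 * u₀A κ Φ t p D (gT mk gx κ Φ t p D) (fT mk fx κ Φ t p D) * ((j : ℤ) + 1) - 1 - E ≤ P.lev du x z := by rw [← hrP 0]; exact hlev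
  obtain ⟨hT1, -⟩ := NrX_spec κ Φ t p D (gT mk gx κ Φ t p D) (fT mk fx κ Φ t p D) P hN (yLXFs κ Φ t p D c mk (gT mk gx κ Φ t p D) (fT mk fx κ Φ t p D) (sgOf du)) 1 x du z hX
  have hT0 := T0X_eq P x du hd z
  have hfar := hfar_of_NrX κ Φ t p D (gT mk gx κ Φ t p D) (fT mk fx κ Φ t p D) P hN (yLXFs κ Φ t p D c mk (gT mk gx κ Φ t p D) (fT mk fx κ Φ t p D) (sgOf du)) hσT x du hd z hX
  obtain ⟨n1, n2⟩ := abs_le.1 hT1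
  -- the shifted contact for p1's aligned-centre transverse rows (see `abs_add_signShift`)
  set Az : ℤ := z 1 - P.cenS x 1 with hAz
  let zsh : Site 2 := fun k => if k = 1 then (fcellsA κ Φ t p D (gT mk gx κ Φ t p D) (fT mk fx κ Φ t p D)).cen x 1 + (Az + (if 0 ≤ Az then (P.c 0 : ℤ) else -(P.c 0 : ℤ))) else z k
  have hzsh : |zsh 1 - (fcellsA κ Φ t p D (gT mk gx κ Φ t p D) (fT mk fx κ Φ t p D)).cen x 1| = |z 1 - P.cenS x 1| + P.c 0 := by
    show |((fcellsA κ Φ t p D (gT mk gx κ Φ t p D) (fT mk fx κ Φ t p D)).cen x 1 + (Az + (if 0 ≤ Az then (P.c 0 : ℤ) else -(P.c 0 : ℤ)))) - (fcellsA κ Φ t p D (gT mk gx κ Φ t p D) (fT mk fx κ Φ t p D)).cen x 1| = |Az| + P.c 0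
    rw [add_sub_cancel_left]; exact abs_add_signShift Az (P.c 0) hc0
  have hfw1 : |zsh 1 - (fcellsA κ Φ t p D (gT mk gx κ Φ t p D) (fT mk fx κ Φ t p D)).cen x 1| + 8 * u₁A κ Φ t p D (gT mk gx κ Φ t p D) (fT mk fx κ Φ t p D) + 8 ≤ 5 * (((fcellsA κ Φ t p D (gT mk gx κ Φ t p D) (fT mk fx κ Φ t p D)).r 1 : ℕ) : ℤ) := by
    rw [hzsh, ← hrP 1]; linarith
  have eroom : (5 * (P.r 1 : ℤ) - 4 - 3 - P.c 0 - |z 1 - P.cenS x 1|) = 5 * (((fcellsA κ Φ t p D (gT mk gx κ Φ t p D) (fT mk fx κ Φ t p D)).r 1 : ℕ) : ℤ) - 4 - 3 - |zsh 1 - (fcellsA κ Φ t p D (gT mk gx κ Φ t p D) (fT mk fx κ Φ t p D)).cen x 1| := by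
    rw [hzsh, hrP 1]; ring
  have hF' := F1cA_yTX0_sub_abs_le κ Φ t p D (gT mk gx κ Φ t p D) (fT mk fx κ Φ t p D) hN (yLXFs κ Φ t p D c mk (gT mk gx κ Φ t p D) (fT mk fx κ Φ t p D) (sgOf du)) 1
  have htan := tanX_pos_XW κ Φ t p D (gT mk gx κ Φ t p D) (fT mk fx κ Φ t p D) P (yLXFs κ Φ t p D c mk (gT mk gx κ Φ t p D) (fT mk fx κ Φ t p D) (sgOf du)) x du hd z hz hkE2 hr1 hu1 hq1 he1 _ hF' (bwX κ Φ t p D (gT mk gx κ Φ t p D) (fT mk fx κ Φ t p D))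
  have eF1 := F1cA_crossOffX κ Φ t p D (gT mk gx κ Φ t p D) (fT mk fx κ Φ t p D) (yLXFs κ Φ t p D c mk (gT mk gx κ Φ t p D) (fT mk fx κ Φ t p D) (sgOf du)) (sgOf du) 1 (NrX κ Φ t p D (gT mk gx κ Φ t p D) (fT mk fx κ Φ t p D) P (yLXFs κ Φ t p D c mk (gT mk gx κ Φ t p D) (fT mk fx κ Φ t p D) (sgOf du)) 1 x du z)
  refine ⟨?_, ?_, hσT, ?_, ?_, ?_, ?_, ?_, ?_, ?_, ?_, ?_, ?_, ?_, ?_, ?_, ?_, ?_, ?_, ?_, ?_, ?_, ?_, ?_, ?_, ?_, ?_⟩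
  · exact hfR_XA κ Φ t p D c mk (gT mk gx κ Φ t p D) (fT mk fx κ Φ t p D) P hP x du hd j hj z hlev1 hlev2 hz hEu hkF0 hkF1 hs0 hkE8
  · exact hZfar_XW κ Φ t p D c mk (gT mk gx κ Φ t p D) (fT mk fx κ Φ t p D) P hP x du hd j hj z hlev2 hEu hkF0
  · intro _ k hk
    rw [hd, hrP 0, es0]
    exact FX1_XAR0 κ Φ t p D (gT mk gx κ Φ t p D) (fT mk fx κ Φ t p D) mk hN hκ hnA hℓA hs0 (yLXFs κ Φ t p D c mk (gT mk gx κ Φ t p D) (fT mk fx κ Φ t p D) (sgOf du)) hΛ₀ hq4 hE2 hlevA (hkN k hk)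
  · intro hσ1 k hk
    rw [hd]
    have e : sgOf du * FcA κ Φ t p D (gT mk gx κ Φ t p D) (fT mk fx κ Φ t p D) (yLXFs κ Φ t p D c mk (gT mk gx κ Φ t p D) (fT mk fx κ Φ t p D) (sgOf du)) = FcA κ Φ t p D (gT mk gx κ Φ t p D) (fT mk fx κ Φ t p D) (yLXFs κ Φ t p D c mk (gT mk gx κ Φ t p D) (fT mk fx κ Φ t p D) (sgOf du)) := by rw [hσ1, one_mul]
    have hrP0 := hrP 0
    have hfar' : FcA κ Φ t p D (gT mk gx κ Φ t p D) (fT mk fx κ Φ t p D) (yLXFs κ Φ t p D c mk (gT mk gx κ Φ t p D) (fT mk fx κ Φ t p D) (sgOf du)) + u₀A κ Φ t p D (gT mk gx κ Φ t p D) (fT mk fx κ Φ t p D) * (((NrX κ Φ t p D (gT mk gx κ Φ t p D) (fT mk fx κ Φ t p D) P (yLXFs κ Φ t p D c mk (gT mk gx κ Φ t p D) (fT mk fx κ Φ t p D) (sgOf du)) 1 x du z) : ℤ) + 1) ≤ 20 * (((fcellsA κ Φ t p D (gT mk gx κ Φ t p D) (fT mk fx κ Φ t p D)).r 0 : ℕ)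 : ℤ) - P.lev du x z + 3 * u₀A κ Φ t p D (gT mk gx κ Φ t p D) (fT mk fx κ Φ t p D) := by linarith
    rw [hrP 0]
    exact FX2_XA'R0 κ Φ t p D (gT mk gx κ Φ t p D) (fT mk fx κ Φ t p D) mk hN hκ hnA hℓA (yLXFs κ Φ t p D c mk (gT mk gx κ Φ t p D) (fT mk fx κ Φ t p D) (sgOf du)) hq4 hNr1000 hfar' hk
  · intro _ k hk
    rw [hd, hrP 0, es0]
    exact FX3_XAR0 κ Φ t p D (gT mk gx κ Φ t p D) (fT mk fx κ Φ t p D) mk hN hκ hnA hℓA hs0 (yLXFs κ Φ t p D c mk (gT mk gx κ Φ t p D) (fT mk fx κ Φ t p D) (sgOf du)) hΛ₀ hq4 hE2 hlevA (hkN k hk)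
  · intro hσ1 k hk
    rw [hd]
    have e : sgOf du * FcA κ Φ t p D (gT mk gx κ Φ t p D) (fT mk fx κ Φ t p D) (yLXFs κ Φ t p D c mk (gT mk gx κ Φ t p D) (fT mk fx κ Φ t p D) (sgOf du)) = -FcA κ Φ t p D (gT mk gx κ Φ t p D) (fT mk fx κ Φ t p D) (yLXFs κ Φ t p D c mk (gT mk gx κ Φ t p D) (fT mk fx κ Φ t p D) (sgOf du)) := by rw [hσ1, neg_one_mul]
    have hrP0 := hrP 0
    have hfar' : -FcA κ Φ t p D (gT mk gx κ Φ t p D) (fT mk fx κ Φ t p D) (yLXFs κ Φ t p D c mk (gT mk gx κ Φ t p D) (fT mk fx κ Φ t p D) (sgOf du)) + u₀A κ Φ t p D (gT mk gx κ Φ t p D) (fT mk fx κ Φ t p D) * (((NrX κ Φ t p D (gT mk gx κ Φ t p D) (fT mk fx κ Φ t p D) P (yLXFs κ Φ t p D c mk (gT mk gx κ Φ t p D) (fT mk fx κ Φ t p D) (sgOf du)) 1 x du z) : ℤ) + 1) ≤ 20 * (((fcellsA κ Φ t p D (gT mk gx κ Φ t p D) (fT mk fx κ Φ t p D)).r 0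 : ℕ) : ℤ) - P.lev du x z + 3 * u₀A κ Φ t p D (gT mk gx κ Φ t p D) (fT mk fx κ Φ t p D) := by linarith
    rw [hrP 0]
    exact FX4_XA'R0 κ Φ t p D (gT mk gx κ Φ t p D) (fT mk fx κ Φ t p D) mk hN hκ hnA hℓA (yLXFs κ Φ t p D c mk (gT mk gx κ Φ t p D) (fT mk fx κ Φ t p D) (sgOf du)) hq4 hNr1000 hfar' hk
  · intro k hk
    rw [hd, show oth (0 : Fin 2) = 1 from rfl, eroom]
    exact FX5_XAR0 κ Φ t p D (gT mk gx κ Φ t p D) (fT mk fx κ Φ t p D) mk hN hκ hℓA (yLXFs κ Φ t p D c mk (gT mk gx κ Φ t p D) (fT mk fx κ Φ t p D) (sgOf du)) hΛ₁3 x zsh 1 hfw1 (hkN k hk)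
  · intro k hk
    rw [hd, show oth (0 : Fin 2) = 1 from rfl, eroom]
    exact FX6_XAR0 κ Φ t p D (gT mk gx κ Φ t p D) (fT mk fx κ Φ t p D) mk hN hκ hℓA (yLXFs κ Φ t p D c mk (gT mk gx κ Φ t p D) (fT mk fx κ Φ t p D) (sgOf du)) hΛ₁3 x zsh 1 hfw1 (hkN k hk)
  · intro hσ1 k hk
    rw [hd]
    rw [hσ1, one_mul] at hT0
    have hnear : 20 * (P.r 0 : ℤ) - P.lev du x z - 2 * u₀A κ Φ t p D (gT mk gx κ Φ t p D) (fT mk fx κ Φ t p D) ≤ FcA κ Φ t p D (gT mk gx κ Φ t p D) (fT mk fx κ Φ t p D) ((yLXFs κ Φ t p D c mk (gT mk gx κ Φ t p D) (fT mk fx κ Φ t p D) (sgOf du)) + Skelφ.crossOffX (nL κ Φ t p D (gT mk gx κ Φ t p D) (fT mk fx κ Φ t p D)) (hL κ Φ t p D (gT mk gx κ Φ t p D) (fT mk fx κ Φ t p D)) (vL κ Φ t p D (gT mk gx κ Φ t p D) (fT mk fx κ Φ t p D)) (sgOf du) 1 (NrX κ Φ t p D (gT mk gx κ Φ t p D) (fT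 mk fx κ Φ t p D) P (yLXFs κ Φ t p D c mk (gT mk gx κ Φ t p D) (fT mk fx κ Φ t p D) (sgOf du)) 1 x du z)) := by linarith
    try rw [es0]
    exact FY1_XA κ Φ t p D (gT mk gx κ Φ t p D) (fT mk fx κ Φ t p D) P hP mk hN hκ hnA24 hℓA ((yLXFs κ Φ t p D c mk (gT mk gx κ Φ t p D) (fT mk fx κ Φ t p D) (sgOf du)) + Skelφ.crossOffX (nL κ Φ t p D (gT mk gx κ Φ t p D) (fT mk fx κ Φ t p D)) (hL κ Φ t p D (gT mk gx κ Φ t p D) (fT mk fx κ Φ t p D)) (vL κ Φ t p D (gT mk gx κ Φ t p D) (fT mk fx κ Φ t p D)) (sgOf du) 1 (NrX κ Φ t p D (gT mk gx κ Φ t p D) (fT mk fx κ Φ t p D) P (yLXFs κ Φ t p D c mk (gT mk gx κ Φ t p D) (fT mk fx κ Φ t p D) (sgOf du)) 1 x du z)) (hk3 k hk) hjr hnear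
  · intro hσ1 k hk
    rw [hd]
    rw [hσ1, one_mul] at hT0
    have hfarT : FcA κ Φ t p D (gT mk gx κ Φ t p D) (fT mk fx κ Φ t p D) ((yLXFs κ Φ t p D c mk (gT mk gx κ Φ t p D) (fT mk fx κ Φ t p D) (sgOf du)) + Skelφ.crossOffX (nL κ Φ t p D (gT mk gx κ Φ t p D) (fT mk fx κ Φ t p D)) (hL κ Φ t p D (gT mk gx κ Φ t p D) (fT mk fx κ Φ t p D)) (vL κ Φ t p D (gT mk gx κ Φ t p D) (fT mk fx κ Φ t p D)) (sgOf du) 1 (NrX κ Φ t p D (gT mk gx κ Φ t p D) (fT mk fx κ Φ t p D) P (yLXFs κ Φ t p D c mk (gT mk gx κ Φ t p D) (fT mk fx κ Φ t p D) (sgOf du)) 1 x du z)) ≤ 20 * (P.r 0 : ℤ) - P.lev du x z + 2 * u₀A κ Φ t p D (gT mk gx κ Φ t p D) (fT mk fx κ Φ t p D) := by linarith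
    try rw [es0]
    exact FY2_XA κ Φ t p D (gT mk gx κ Φ t p D) (fT mk fx κ Φ t p D) P hP mk hN hκ hnA24 hℓA ((yLXFs κ Φ t p D c mk (gT mk gx κ Φ t p D) (fT mk fx κ Φ t p D) (sgOf du)) + Skelφ.crossOffX (nL κ Φ t p D (gT mk gx κ Φ t p D) (fT mk fx κ Φ t p D)) (hL κ Φ t p D (gT mk gx κ Φ t p D) (fT mk fx κ Φ t p D)) (vL κ Φ t p D (gT mk gx κ Φ t p D) (fT mk fx κ Φ t p D)) (sgOf du) 1 (NrX κ Φ t p D (gT mk gx κ Φ t p D) (fT mk fx κ Φ t p D) P (yLXFs κ Φ t p D c mk (gT mk gx κ Φ t p D) (fT mk fx κ Φ t p D) (sgOf du)) 1 x du z)) (hk3 k hk) hfarT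
  · intro hσ1 k hk
    rw [hd]
    rw [hσ1, neg_one_mul] at hT0
    have hnear : 20 * (P.r 0 : ℤ) - P.lev du x z - 2 * u₀A κ Φ t p D (gT mk gx κ Φ t p D) (fT mk fx κ Φ t p D) ≤ -FcA κ Φ t p D (gT mk gx κ Φ t p D) (fT mk fx κ Φ t p D) ((yLXFs κ Φ t p D c mk (gT mk gx κ Φ t p D) (fT mk fx κ Φ t p D) (sgOf du)) + Skelφ.crossOffX (nL κ Φ t p D (gT mk gx κ Φ t p D) (fT mk fx κ Φ t p D)) (hL κ Φ t p D (gT mk gx κ Φ t p D) (fT mk fx κ Φ t p D)) (vL κ Φ t p D (gT mk gx κ Φ t p D) (fT mk fx κ Φ t p D)) (sgOf du) 1 (NrX κ Φ t p D (gT mk gx κ Φ t p D) (fT mk fx κ Φ t p D) P (yLXFs κ Φ t p D c mk (gT mk gx κ Φ t p D) (fT mk fx κ Φ t p D) (sgOf du)) 1 x du z)) := by linarith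
    try rw [es0]
    exact FY3_XA κ Φ t p D (gT mk gx κ Φ t p D) (fT mk fx κ Φ t p D) P hP mk hN hκ hnA24 hℓA ((yLXFs κ Φ t p D c mk (gT mk gx κ Φ t p D) (fT mk fx κ Φ t p D) (sgOf du)) + Skelφ.crossOffX (nL κ Φ t p D (gT mk gx κ Φ t p D) (fT mk fx κ Φ t p D)) (hL κ Φ t p D (gT mk gx κ Φ t p D) (fT mk fx κ Φ t p D)) (vL κ Φ t p D (gT mk gx κ Φ t p D) (fT mk fx κ Φ t p D)) (sgOf du) 1 (NrX κ Φ t p D (gT mk gx κ Φ t p D) (fT mk fx κ Φ t p D) P (yLXFs κ Φ t p D c mk (gT mk gx κ Φ t p D) (fT mk fx κ Φ t p D) (sgOf du)) 1 x du z)) (hk3 k hk) hjr hnear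
  · intro hσ1 k hk
    rw [hd]
    rw [hσ1, neg_one_mul] at hT0
    have hfarT : -FcA κ Φ t p D (gT mk gx κ Φ t p D) (fT mk fx κ Φ t p D) ((yLXFs κ Φ t p D c mk (gT mk gx κ Φ t p D) (fT mk fx κ Φ t p D) (sgOf du)) + Skelφ.crossOffX (nL κ Φ t p D (gT mk gx κ Φ t p D) (fT mk fx κ Φ t p D)) (hL κ Φ t p D (gT mk gx κ Φ t p D) (fT mk fx κ Φ t p D)) (vL κ Φ t p D (gT mk gx κ Φ t p D) (fT mk fx κ Φ t p D)) (sgOf du) 1 (NrX κ Φ t p D (gT mk gx κ Φ t p D) (fT mk fx κ Φ t p D) P (yLXFs κ Φ t p D c mk (gT mk gx κ Φ t p D) (fT mk fx κ Φ t p D) (sgOf du)) 1 x du z)) ≤ 20 * (P.r 0 : ℤ) - P.lev du x z + 2 * u₀A κ Φ t p D (gT mk gx κ Φ t p D) (fT mk fx κ Φ t p D) := by linarith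
    try rw [es0]
    exact FY4_XA κ Φ t p D (gT mk gx κ Φ t p D) (fT mk fx κ Φ t p D) P hP mk hN hκ hnA24 hℓA ((yLXFs κ Φ t p D c mk (gT mk gx κ Φ t p D) (fT mk fx κ Φ t p D) (sgOf du)) + Skelφ.crossOffX (nL κ Φ t p D (gT mk gx κ Φ t p D) (fT mk fx κ Φ t p D)) (hL κ Φ t p D (gT mk gx κ Φ t p D) (fT mk fx κ Φ t p D)) (vL κ Φ t p D (gT mk gx κ Φ t p D) (fT mk fx κ Φ t p D)) (sgOf du) 1 (NrX κ Φ t p D (gT mk gx κ Φ t p D) (fT mk fx κ Φ t p D) P (yLXFs κ Φ t p D c mk (gT mk gx κ Φ t p D) (fT mk fx κ Φ t p D) (sgOf du)) 1 x du z)) (hk3 k hk) hfarT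
  · intro k hk
    have h := (htan k hk).1
    rw [← eF1] at h
    rw [hd, show oth (0 : Fin 2) = 1 from rfl]
    exact FY5_XA κ Φ t p D (gT mk gx κ Φ t p D) (fT mk fx κ Φ t p D) P 0 mk hN hκ hℓA ((yLXFs κ Φ t p D c mk (gT mk gx κ Φ t p D) (fT mk fx κ Φ t p D) (sgOf du)) + Skelφ.crossOffX (nL κ Φ t p D (gT mk gx κ Φ t p D) (fT mk fx κ Φ t p D)) (hL κ Φ t p D (gT mk gx κ Φ t p D) (fT mk fx κ Φ t p D)) (vL κ Φ t p D (gT mk gx κ Φ t p D) (fT mk fx κ Φ t p D)) (sgOf du) 1 (NrX κ Φ t p D (gT mk gx κ Φ t p D) (fT mk fx κ Φ t p D) P (yLXFs κ Φ t p D c mk (gT mk gx κ Φ t p D) (fT mk fx κ Φ t p D) (sgOf du)) 1 x du z)) x z 1 hσT (hk3 k hk) h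
  · intro k hk
    have h := (htan k hk).2
    rw [← eF1] at h
    rw [hd, show oth (0 : Fin 2) = 1 from rfl]
    exact FY6_XA κ Φ t p D (gT mk gx κ Φ t p D) (fT mk fx κ Φ t p D) P 0 mk hN hκ hℓA ((yLXFs κ Φ t p D c mk (gT mk gx κ Φ t p D) (fT mk fx κ Φ t p D) (sgOf du)) + Skelφ.crossOffX (nL κ Φ t p D (gT mk gx κ Φ t p D) (fT mk fx κ Φ t p D)) (hL κ Φ t p D (gT mk gx κ Φ t p D) (fT mk fx κ Φ t p D)) (vL κ Φ t p D (gT mk gx κ Φ t p D) (fT mk fx κ Φ t p D)) (sgOf du) 1 (NrX κ Φ t p D (gT mk gx κ Φ t p D) (fT mk fx κ Φ t p D) P (yLXFs κ Φ t p D c mk (gT mk gx κ Φ t p D) (fT mk fx κ Φ t p D) (sgOf du)) 1 x du z)) x z 1 hσT (hk3 k hk) h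
  · -- FL1 at the wider window `small3 0 ≥ small 0` (monotone)
    have h := FL1_XA_gen κ Φ t p D (gT mk gx κ Φ t p D) (fT mk fx κ Φ t p D) mk P hN hκ x du z (yLXFs κ Φ t p D c mk (gT mk gx κ Φ t p D) (fT mk fx κ Φ t p D) (sgOf du)) 1 hX hLk hLℓ
    have hmono := mul_le_mul_of_nonneg_left (show P.cenS (x + stepVec du) 0 - ((NegB.BSlot.small3 κ Φ t p D (gT mk gx κ Φ t p D) (fT mk fx κ Φ t p D) 0 : ℕ) : ℤ) + 2 - z 0 - FcA κ Φ t p D (gT mk gx κ Φ t p D) (fT mk fx κ Φ t p D) ((yLXFs κ Φ t p D c mk (gT mk gx κ Φ t p D) (fT mk fx κ Φ t p D) (sgOf du)) + Skelφ.crossOffX (nL κ Φ t p D (gT mk gx κ Φ t p D) (fT mk fx κ Φ t p D)) (hL κ Φ t p D (gT mk gx κ Φ t p D) (fT mk fx κ Φ t p D)) (vL κ Φ t p D (gT mk gx κ Φ t p D) (fT mk fx κ Φ t p D)) (sgOf du) 1 (NrX κ Φ t p D (gT mk gx κ Φ t p D) (fT mk fx κ Φ t p D) P (yLXFs κ Φ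 t p D c mk (gT mk gx κ Φ t p D) (fT mk fx κ Φ t p D) (sgOf du)) 1 x du z)) ≤ P.cenS (x + stepVec du) 0 - ((NegB.BSlot.small κ Φ t p D (gT mk gx κ Φ t p D) (fT mk fx κ Φ t p D) 0 : ℕ) : ℤ) + 2 - z 0 - FcA κ Φ t p D (gT mk gx κ Φ t p D) (fT mk fx κ Φ t p D) ((yLXFs κ Φ t p D c mk (gT mk gx κ Φ t p D) (fT mk fx κ Φ t p D) (sgOf du)) + Skelφ.crossOffX (nL κ Φ t p D (gT mk gx κ Φ t p D) (fT mk fx κ Φ t p D)) (hL κ Φ t p D (gT mk gx κ Φ t p D) (fT mk fx κ Φ t p D)) (vL κ Φ t p D (gT mk gx κ Φ t p D) (fT mk fx κ Φ t p D)) (sgOf du) 1 (NrX κ Φ t p D (gT mk gx κ Φ t p D) (fT mk fx κ Φ t p D) P (yLXFs κ Φ t p D c mk (gT mk gx κ Φ t p D) (fT mk fx κ Φ t p D) (sgOf du)) 1 x du z)) by linarith [hsm0]) hnm0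
    exact le_trans hmono h
  · have h := FL2_XA_gen κ Φ t p D (gT mk gx κ Φ t p D) (fT mk fx κ Φ t p D) mk P hN hκ x du z (yLXFs κ Φ t p D c mk (gT mk gx κ Φ t p D) (fT mk fx κ Φ t p D) (sgOf du)) 1 hX hLk hLℓ
    have hmono := mul_le_mul_of_nonneg_left (show P.cenS (x + stepVec du) 0 + ((NegB.BSlot.small κ Φ t p D (gT mk gx κ Φ t p D) (fT mk fx κ Φ t p D) 0 : ℕ) : ℤ) - 2 - z 0 ≤ P.cenS (x + stepVec du) 0 + ((NegB.BSlot.small3 κ Φ t p D (gT mk gx κ Φ t p D) (fT mk fx κ Φ t p D) 0 : ℕ) : ℤ) - 2 - z 0 by linarith [hsm0]) hnm0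
    exact le_trans h hmono
  · have hNT' : T1X P x du z - (bwX κ Φ t p D (gT mk gx κ Φ t p D) (fT mk fx κ Φ t p D)) ≤ F1cA κ Φ t p D (gT mk gx κ Φ t p D) (fT mk fx κ Φ t p D) (yLXFs κ Φ t p D c mk (gT mk gx κ Φ t p D) (fT mk fx κ Φ t p D) (sgOf du)) + 1 * u₁A κ Φ t p D (gT mk gx κ Φ t p D) (fT mk fx κ Φ t p D) * (((N3WX κ Φ t p D (gT mk gx κ Φ t p D) (fT mk fx κ Φ t p D) P (yLXFs κ Φ t p D c mk (gT mk gx κ Φ t p D) (fT mk fx κ Φ t p D) (sgOf du)) x du z (bwX κ Φ t p D (gT mk gx κ Φ t p D) (fT mk fx κ Φ t p D))) + 1 : ℕ) : ℤ) := by push_cast; linarith [hWlo]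
    exact FL3_XW κ Φ t p D (gT mk gx κ Φ t p D) (fT mk fx κ Φ t p D) mk P hN hκ hu2 x du z (yLXFs κ Φ t p D c mk (gT mk gx κ Φ t p D) (fT mk fx κ Φ t p D) (sgOf du)) (sgOf du) _ hNT' hLℓ
  · have hNT' : F1cA κ Φ t p D (gT mk gx κ Φ t p D) (fT mk fx κ Φ t p D) (yLXFs κ Φ t p D c mk (gT mk gx κ Φ t p D) (fT mk fx κ Φ t p D) (sgOf du)) + 1 * u₁A κ Φ t p D (gT mk gx κ Φ t p D) (fT mk fx κ Φ t p D) * (((N3WX κ Φ t p D (gT mk gx κ Φ t p D) (fT mk fx κ Φ t p D) P (yLXFs κ Φ t p D c mk (gT mk gx κ Φ t p D) (fT mk fx κ Φ t p D) (sgOf du)) x du z (bwX κ Φ t p D (gT mk gx κ Φ t p D) (fT mk fx κ Φ t p D))) + 1 : ℕ) : ℤ) ≤ T1X P x du z + (bwX κ Φ t p D (gT mk gx κ Φ t p D) (fT mk fx κ Φ t p D)) := by push_cast; linarith [hWhi]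
    exact FL4_XW κ Φ t p D (gT mk gx κ Φ t p D) (fT mk fx κ Φ t p D) mk P hN hκ hu2 x du z (yLXFs κ Φ t p D c mk (gT mk gx κ Φ t p D) (fT mk fx κ Φ t p D) (sgOf du)) (sgOf du) _ hNT' hLℓ
  · exact hfit_XA_gen κ Φ t p D mk (gT mk gx κ Φ t p D) (fT mk fx κ Φ t p D) P hP hN hnA x du hd j hj z hlev1 hlev2 hEu (yLXFs κ Φ t p D c mk (gT mk gx κ Φ t p D) (fT mk fx κ Φ t p D) (sgOf du)) 1 he0 _ hq4
  · exact hq₃_XA_gen κ Φ t p D mk (gT mk gx κ Φ t p D) (fT mk fx κ Φ t p D) P hP hN x du hd j hj z hlev1 hlev2 hEu (yLXFs κ Φ t p D c mk (gT mk gx κ Φ t p D) (fT mk fx κ Φ t p D) (sgOf du)) 1 he0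
  · exact hxaXF_s κ Φ t p D c mk (gT mk gx κ Φ t p D) (fT mk fx κ Φ t p D) hσ
  · exact hxbXF_s κ Φ t p D c mk gx fx hN hκ hS hR0 hσ
  · exact hclr_XA_gen κ Φ t p D mk (gT mk gx κ Φ t p D) (fT mk fx κ Φ t p D) P hnA x du z (yLXFs κ Φ t p D c mk (gT mk gx κ Φ t p D) (fT mk fx κ Φ t p D) (sgOf du)) _ hyL 1
  · exact hclr₃_XA_gen κ Φ t p D mk (gT mk gx κ Φ t p D) (fT mk fx κ Φ t p D) P hP hN hκ hnA hℓA x du hd j hj z hlev1 hlev2 hEu (yLXFs κ Φ t p D c mk (gT mk gx κ Φ t p D) (fT mk fx κ Φ t p D) (sgOf du)) hσT _ he0 he1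
  · exact hπ2X_XA_gen κ Φ t p D c mk (gT mk gx κ Φ t p D) (fT mk fx κ Φ t p D) P hP hN x du hd j hj z hlev1 hlev2 hEu (yLXFs κ Φ t p D c mk (gT mk gx κ Φ t p D) (fT mk fx κ Φ t p D) (sgOf du)) 1 he0 hyl r hr
  · exact hπ3X_XA_gen κ Φ t p D c mk (gT mk gx κ Φ t p D) (fT mk fx κ Φ t p D) P hP hN hκ hℓA x du hd j hj z hlev1 hlev2 hEu (yLXFs κ Φ t p D c mk (gT mk gx κ Φ t p D) (fT mk fx κ Φ t p D) (sgOf du)) hσT hN3 he0 hyl r hr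

/-- **The one-sided x counts' ranges at the origin `yLXFs`** (what the packager reads for the capped witnesses): `NrX … 1 … + 1 ≤ 600·Kq` and
`N3WX + 1 ≤ 240·Kq + 10`. [folklore] -/
theorem rangesX_XFsW (κ : Consts) {V : Type} [DecidableEq V] [Countable V] {G : SimpleGraph V} [G.LocallyFinite] (Φ : PlanarSkeletonFrmFrom G) (t : V) (p : unitInterval) (D : Skelφ.StepI.DataNS V) (c : ℕ) (mk : ℕ) (gx : Neg.FSlot) (fx : Neg.FSlot) (P : PCells2T) (hP : P.toPCells2 = fcellsA κ Φ t p D (gT mk gx κ Φ t p D) (fT mk fx κ Φ t p D))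
    (hN : EqNumL κ Φ t p D (gT mk gx κ Φ t p D) (fT mk fx κ Φ t p D)) (hκ : (hL κ Φ t p D (gT mk gx κ Φ t p D) (fT mk fx κ Φ t p D)).natAbs ≤ 10 * nL κ Φ t p D (gT mk gx κ Φ t p D) (fT mk fx κ Φ t p D))
    (hS : 16 * SF κ Φ t p D c mk ≤ ML κ Φ t p D (gT mk gx κ Φ t p D)) (hR0 : 22000 * (KS0.R'0 κ Φ t p D mk + 2) ≤ ML κ Φ t p D (gT mk gx κ Φ t p D))
    (x : Site 2) (du : MDir) (hd : du.1 = 0) (j : ℕ) (hj : j < P.K) (z : Site 2) {E : ℕ} {kE : ℤ}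
    (hlev1 : (P.faceL 0 j : ℤ) - E ≤ P.lev du x z) (hlev2 : P.lev du x z ≤ P.faceL 0 j + E)
    (hz : |z 1 - P.cenS x 1| ≤ kE) (hEu : (E : ℤ) ≤ u₀A κ Φ t p D (gT mk gx κ Φ t p D) (fT mk fx κ Φ t p D)) (hkE : kE ≤ 5 * (P.r 1 : ℤ))
    (hTw : 3 * u₁A κ Φ t p D (gT mk gx κ Φ t p D) (fT mk fx κ Φ t p D) ≤ T1X P x du z + (bwX κ Φ t p D (gT mk gx κ Φ t p D) (fT mk fx κ Φ t p D))) :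
    NrX κ Φ t p D (gT mk gx κ Φ t p D) (fT mk fx κ Φ t p D) P (yLXFs κ Φ t p D c mk (gT mk gx κ Φ t p D) (fT mk fx κ Φ t p D) (sgOf du)) 1 x du z + 1 ≤ 600 * Neg.Kq κ ∧
      N3WX κ Φ t p D (gT mk gx κ Φ t p D) (fT mk fx κ Φ t p D) P (yLXFs κ Φ t p D c mk (gT mk gx κ Φ t p D) (fT mk fx κ Φ t p D) (sgOf du)) x du z (bwX κ Φ t p D (gT mk gx κ Φ t p D) (fT mk fx κ Φ t p D)) + 1 ≤ 240 * Neg.Kq κ + 10 := by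
  have hσ : sgOf du = 1 ∨ sgOf du = -1 := sgOf_sign du
  obtain ⟨hΛ₀, hΛ₁⟩ := Λ_yLXFs κ Φ t p D c mk (fT mk fx κ Φ t p D) gx hN hκ hS hR0 hσ
  have hσT : (1 : ℤ) = 1 ∨ (1 : ℤ) = -1 := Or.inl rfl
  have he0 := he0_of_Λ₀ κ Φ t p D (gT mk gx κ Φ t p D) (fT mk fx κ Φ t p D) hN (yLXFs κ Φ t p D c mk (gT mk gx κ Φ t p D) (fT mk fx κ Φ t p D) (sgOf du)) hΛ₀ hσT
  have he1 := he1_of_Λ₁ κ Φ t p D (gT mk gx κ Φ t p D) (fT mk fx κ Φ t p D) hN (yLXFs κ Φ t p D c mk (gT mk gx κ Φ t p D) (fT mk fx κ Φ t p D) (sgOf du)) hΛ₁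
  have hu0 : 1 ≤ u₀A κ Φ t p D (gT mk gx κ Φ t p D) (fT mk fx κ Φ t p D) := (units_eqA κ Φ t p D (gT mk gx κ Φ t p D) (fT mk fx κ Φ t p D)).2.2.2.2.1
  have hu1 : 1 ≤ u₁A κ Φ t p D (gT mk gx κ Φ t p D) (fT mk fx κ Φ t p D) := (units_eqA κ Φ t p D (gT mk gx κ Φ t p D) (fT mk fx κ Φ t p D)).2.2.2.2.2
  have hbw2 : u₁A κ Φ t p D (gT mk gx κ Φ t p D) (fT mk fx κ Φ t p D) ≤ 2 * ((bwX κ Φ t p D (gT mk gx κ Φ t p D) (fT mk fx κ Φ t p D)) : ℤ) := (bwX_eq κ Φ t p D (gT mk gx κ Φ t p D) (fT mk fx κ Φ t p D)).2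
  have he1t : |F1cA κ Φ t p D (gT mk gx κ Φ t p D) (fT mk fx κ Φ t p D) (yLXFs κ Φ t p D c mk (gT mk gx κ Φ t p D) (fT mk fx κ Φ t p D) (sgOf du))| ≤ 2 * u₁A κ Φ t p D (gT mk gx κ Φ t p D) (fT mk fx κ Φ t p D) := abs_F1cA_le_of_Λ₁ κ Φ t p D (gT mk gx κ Φ t p D) (fT mk fx κ Φ t p D) hN (yLXFs κ Φ t p D c mk (gT mk gx κ Φ t p D) (fT mk fx κ Φ t p D) (sgOf du)) hΛ₁
  have hFst : F1cA κ Φ t p D (gT mk gx κ Φ t p D) (fT mk fx κ Φ t p D) (yLXFs κ Φ t p D c mk (gT mk gx κ Φ t p D) (fT mk fx κ Φ t p D) (sgOf du)) + u₁A κ Φ t p D (gT mk gx κ Φ t p D) (fT mk fx κ Φ t p D) ≤ T1X P x du z + (bwX κ Φ t p D (gT mk gx κ Φ t p D) (fT mk fx κ Φ t p D)) := by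
    have := (abs_le.1 he1t).2; linarith
  exact ⟨(NrX_range κ Φ t p D (gT mk gx κ Φ t p D) (fT mk fx κ Φ t p D) P hP hN x du hd z hj hlev1 hlev2 (yLXFs κ Φ t p D c mk (gT mk gx κ Φ t p D) (fT mk fx κ Φ t p D) (sgOf du)) _ he0 (by linarith)).2,
    N3WX_range κ Φ t p D (gT mk gx κ Φ t p D) (fT mk fx κ Φ t p D) P hP (yLXFs κ Φ t p D c mk (gT mk gx κ Φ t p D) (fT mk fx κ Φ t p D) (sgOf du)) x du hd z hz hkE he1 (by linarith) hbw2 hFst⟩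

end KS

end NegB

end PlanarSkeletonFrmFrom

end Summit.CriticalPhenomena.PercolationContinuityZ3.Theorems.Transplant

end
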